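import Summits.Ventures.QEC.CircuitDistance.ETowerZeroMini345XD
import HarnessLib

/-!
# #345 X tower, level C by the (α) MINI-TOWER — UNIT FACTS of the mini base (ZERO-CERT §2)
(cell `qec`, experiment CDX; emitter idea-1 g5 `emit_mini345.py`)

For every one of the 4811 base classes `t ∈ T3c` (weight-≤-5 kernel classes of `cu3`, least translates): `t < 2^45` and the mini node
`nodeAm (bitsOf 45 0 t)` passes (step A′ lifts into `ker cu2`, step B′ lifts into `ker cu1`, top continuation `kCm` = least-translate
membership in `0 :: DC`) — chunked `decide +kernel`, glued to `unitsAm : ∀ t ∈ T3c, t < 2 ^ 45 ∧ nodeAm (bitsOf 45 0 t) = true`.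
Nothing here asserts a value of `d_circ`.
-/

set_option maxRecDepth 100000
set_option exponentiation.threshold 1024
set_option linter.unusedVariables false

namespace Summit.Ventures.QEC.CircuitDistance.ETower.Sec345X.Zeros

open Summit.Ventures.QEC.Census Summit.Ventures.QEC.Census.Fold Summit.Ventures.QEC.CircuitDistance.ETower

set_option maxHeartbeats 400000000 in
/-- MINI UNIT FACTS 1/5: base classes 0…962 are < 2^45 and pass `nodeAm`. -/
theorem unitsAm_0 : (((T3c.drop 0).take 963).all fun t => decide (t < 2 ^ 45) && nodeAm (bitsOf 45 0 t)) = true := by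
  decide +kernel

set_option maxHeartbeats 400000000 in
/-- MINI UNIT FACTS 2/5: base classes 963…1925 are < 2^45 and pass `nodeAm`. -/
theorem unitsAm_1 : (((T3c.drop 963).take 963).all fun t => decide (t < 2 ^ 45) && nodeAm (bitsOf 45 0 t)) = true := by
  decide +kernel

set_option maxHeartbeats 400000000 in
/-- MINI UNIT FACTS 3/5: base classes 1926…2888 are < 2^45 and pass `nodeAm`. -/
theorem unitsAm_2 : (((T3c.drop 1926).take 963).all fun t => decide (t < 2 ^ 45) && nodeAm (bitsOf 45 0 t)) = true := by
  decide +kernel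

set_option maxHeartbeats 400000000 in
/-- MINI UNIT FACTS 4/5: base classes 2889…3851 are < 2^45 and pass `nodeAm`. -/
theorem unitsAm_3 : (((T3c.drop 2889).take 963).all fun t => decide (t < 2 ^ 45) && nodeAm (bitsOf 45 0 t)) = true := by
  decide +kernel

set_option maxHeartbeats 400000000 in
/-- MINI UNIT FACTS 5/5: base classes 3852…4810 are < 2^45 and pass `nodeAm`. -/
theorem unitsAm_4 : (((T3c.drop 3852).take 959).all fun t => decide (t < 2 ^ 45) && nodeAm (bitsOf 45 0 t)) = true := by
  decide +kernel

/-- MINI UNIT FACTS (all 4811). -/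
theorem unitsAm_all : (T3c.all fun t => decide (t < 2 ^ 45) && nodeAm (bitsOf 45 0 t)) = true := by
  have hlen : T3c.length = 4811 := by decide +kernel
  rw [List.all_eq_true]
  intro t ht
  obtain ⟨i, hi, rfl⟩ := List.getElem_of_mem ht
  have key : ∀ lo n : ℕ, (((T3c.drop lo).take n).all fun t => decide (t < 2 ^ 45) && nodeAm (bitsOf 45 0 t)) = true →
      lo ≤ i → i < lo + n → (decide (T3c[i] < 2 ^ 45) && nodeAm (bitsOf 45 0 T3c[i])) = true := by
    intro lo n h hlo hhi
    rw [List.all_eq_true] at h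
    apply h
    rw [List.mem_take_iff_getElem]
    refine ⟨i - lo, ?_, ?_⟩
    · simp only [List.length_drop]; omega
    · simp only [List.getElem_drop]; congr 1; omega
  have hi' : i < 4811 := hlen ▸ hi
  by_cases h0 : i < 963
  · exact key 0 963 unitsAm_0 (by omega) (by omega)
  by_cases h1 : i < 1926
  · exact key 963 963 unitsAm_1 (by omega) (by omega)
  by_cases h2 : i < 2889
  · exact key 1926 963 unitsAm_2 (by omega) (by omega)
  by_cases h3 : i < 3852
  · exact key 2889 963 unitsAm_3 (by omega) (by omega)
  exact key 3852 959 unitsAm_4 (by omega) (by omega)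

/-- ★ MINI UNIT FACTS in binder shape. -/
theorem unitsAm : ∀ t ∈ T3c, t < 2 ^ 45 ∧ nodeAm (bitsOf 45 0 t) = true := by
  intro t ht
  have h := (List.all_eq_true.1 unitsAm_all) t ht
  rw [Bool.and_eq_true, decide_eq_true_eq] at h
  exact h

end Summit.Ventures.QEC.CircuitDistance.ETower.Sec345X.Zeros
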